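import Mathlib
import Literature.MathematicalPhysics.QuantumFieldTheory.LatticeGaugeProofs
import Literature.MathematicalPhysics.QuantumFieldTheory.LatticeGaugeStaticPotentialProofs
import Literature.MathematicalPhysics.QuantumFieldTheory.YangMillsOS
import Literature.MathematicalPhysics.QuantumLattice.LatticeGaugeDLR
import HarnessLib

/-!
# Stub `stub_axisIsotropy` of the line `sup-axis-reflection-transfer` (crux `FiniteSusceptibilityWeakCoupling`)

Route `FradkinShenkerFlow` of `YangMills`, crux item `stmt-QuantumFields-9442`
(`Summit.QuantumFields.YangMills.Theses.FradkinShenkerFlow.FiniteSusceptibilityWeakCoupling`), line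
`sup-axis-reflection-transfer`, stub `stub_axisIsotropy` (STUB 4 of the lead's registered skeleton).

**What is proved (axis isotropy of cubic axis moments).** For every compact group `G`, every lattice
representation `r` and EVERY coupling `β`: if every pair of species `A, B : YMSpecies G` has
`S`-uniformly bounded cubic moments `Σ_{n ≤ S} (n+1)³ |Cov_S(A∘lift, B∘τ_{n e₀}∘lift)|` of its covariances
under the torus Wilson state `wilsonMeasure (2S+1) r.ρ β` along the Euclidean-time axis `0`, then the same
holds along every axis `μ : Fin 4`.

**Mechanism.** Let `π = Equiv.swap 0 μ`. The permuted species `A^π := A ∘ configPermZd π`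
(`AxisIsotropy.permSpecies`) is again a `YMSpecies` (cylinder on the permuted support by
`IsCylinder.comp_configPermZd`; gauge invariant because `configPermZd π` intertwines `gaugeTransformZd g`
with `gaugeTransformZd (g ∘ sitePermZd π⁻¹)`; bounded; measurable). The periodic lift intertwines the
coordinate permutations of `ℤ⁴` and of the torus (`toTorusObservable_comp_configPermZd`), `configPermZd π`
conjugates `configShift v` to `configShift (sitePermZd π v)` and `sitePermZd π (n e₀) = n e_μ`
(`sitePermZd_single`), and the torus Wilson state is invariant under `configPerm π`
(`wilsonMeasure_map_configPerm`, which needs only `r.continuous`, no sign of `β`). Hence, TERM BY TERM,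
`Cov_S(A∘lift, B∘τ_{n e_μ}∘lift) = Cov_S(A^π∘lift, B^π∘τ_{n e₀}∘lift)` (`AxisIsotropy.covariance_perm`,
via Mathlib's `covariance_map_equiv`), and the hypothesis' bound for the pair `(A^π, B^π)` works verbatim.
-/

noncomputable section

open MeasureTheory ProbabilityTheory
open Literature.MathematicalPhysics.QuantumFieldTheory hiding ZdEdge
open Literature.MathematicalPhysics.QuantumLattice

namespace Summit.QuantumFields.YangMills.Theorems.FiniteSusceptibilityWeakCoupling

namespace AxisIsotropy

/-- `sitePermZd` commutes with negation (it is additive). [folklore] -/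
theorem sitePermZd_neg {d : ℕ} (π : Equiv.Perm (Fin d)) (x : Literature.Probability.LatticeModels.Site d) :
    sitePermZd π (-x) = -sitePermZd π x := rfl

/-- `sitePermZd` commutes with subtraction (it is additive). [folklore] -/
theorem sitePermZd_sub {d : ℕ} (π : Equiv.Perm (Fin d)) (x y : Literature.Probability.LatticeModels.Site d) :
    sitePermZd π (x - y) = sitePermZd π x - sitePermZd π y := rfl

/-- `sitePermZd π⁻¹` is a left inverse of `sitePermZd π`. [folklore] -/
theorem sitePermZd_symm_sitePermZd {d : ℕ} (π : Equiv.Perm (Fin d))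
    (x : Literature.Probability.LatticeModels.Site d) : sitePermZd π.symm (sitePermZd π x) = x := by
  funext j
  simp only [sitePermZd_apply, Equiv.symm_symm, Equiv.symm_apply_apply]

variable {G : Type} [MeasurableSpace G]

/-- **Coordinate permutations conjugate the translations**:
`configPermZd π (θ_v V) = θ_{π v} (configPermZd π V)`. [folklore] -/
theorem configPermZd_configShift {d : ℕ} (π : Equiv.Perm (Fin d))
    (v : Literature.Probability.LatticeModels.Site d) (V : LGConfig d G) :
    configPermZd π (configShift v V) = configShift (sitePermZd π v) (configPermZd π V) := by
  funext e
  simp only [configPermZd_apply, configShift_apply, sitePermZd_sub, sitePermZd_symm_sitePermZd]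

/-- **The periodic lift intertwines the coordinate permutations** of `ℤ^d` and of the torus:
`configPermZd π (torusLift L U) = torusLift L (configPerm π U)` (pointwise form of the tree's
`toTorusObservable_comp_configPermZd`). [folklore] -/
theorem configPermZd_torusLift {d : ℕ} (L : ℕ) (π : Equiv.Perm (Fin d)) (U : GaugeConfig d L G) :
    configPermZd π (torusLift L U) = torusLift L (configPerm π U) :=
  congrFun (toTorusObservable_comp_configPermZd (G := G) L π (id : LGConfig d G → LGConfig d G)) U

variable [Group G]

/-- **Coordinate permutations intertwine the gauge transformations**:
`configPermZd π (U^g) = (configPermZd π U)^{g ∘ sitePermZd π⁻¹}`. [folklore] -/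
theorem configPermZd_gaugeTransformZd {d : ℕ} (π : Equiv.Perm (Fin d))
    (g : Literature.Probability.LatticeModels.Site d → G) (U : LGConfig d G) :
    configPermZd π (gaugeTransformZd g U) =
      gaugeTransformZd (g ∘ sitePermZd π.symm) (configPermZd π U) := by
  funext e
  simp only [configPermZd_apply, gaugeTransformZd, Function.comp_apply, sitePermZd_add,
    sitePermZd_single]

/-- **Permuted species.** The coordinate permutation `A^π := A ∘ configPermZd π` of a local
gauge-invariant observable `A` of lattice `G`-gauge theory on `ℤ⁴` is again one: a cylinder function of
the permuted support (`IsCylinder.comp_configPermZd`), gauge invariant (`configPermZd_gaugeTransformZd`),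
bounded by the same constant, and measurable (`configPermZd π` is a measurable equivalence). [folklore] -/
def permSpecies (π : Equiv.Perm (Fin 4)) (A : YMSpecies G) : YMSpecies G where
  F := A.F ∘ configPermZd π
  supp := A.supp.image fun e => (sitePermZd π.symm e.1, π.symm e.2)
  isCylinder :=
    Literature.MathematicalPhysics.QuantumFieldTheory.IsCylinder.comp_configPermZd A.isCylinder π
  gaugeInvariant g U := by
    simp only [Function.comp_apply, configPermZd_gaugeTransformZd]
    exact A.gaugeInvariant _ _
  bounded := by
    obtain ⟨C, hC⟩ := A.bounded
    exact ⟨C, fun U => hC _⟩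
  measurable := A.measurable.comp (configPermZd π).measurable

/-- The permuted species evaluated: `(A^π).F U = A.F (configPermZd π U)`. [folklore] -/
@[simp] theorem permSpecies_F (π : Equiv.Perm (Fin 4)) (A : YMSpecies G) (U : LGConfig 4 G) :
    (permSpecies π A).F U = A.F (configPermZd π U) := rfl

variable [TopologicalSpace G] [IsTopologicalGroup G] [CompactSpace G] [BorelSpace G]

/-- **Key identity (term-by-term transport of axis covariances).** For every permutation `π` of the
four axes, every translate `v ∈ ℤ⁴` and every torus `2S+1`:
`Cov_S(A∘lift, B∘θ_{π v}∘lift) = Cov_S(A^π∘lift, B^π∘θ_v∘lift)` under `wilsonMeasure (2S+1) r.ρ β` — the two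
integrands on the right are the two on the left composed with the measurable equivalence `configPerm π`
(`configPermZd_torusLift`, `configPermZd_configShift`), which preserves the torus Wilson state
(`wilsonMeasure_map_configPerm`); Mathlib `covariance_map_equiv`. Every compact `G`, every `β`. [folklore] -/
theorem covariance_perm (r : LatticeRep G) (β : ℝ) (π : Equiv.Perm (Fin 4)) (A B : YMSpecies G)
    (S : ℕ) (v : Literature.Probability.LatticeModels.Site 4) :
    cov[fun U => A.F (torusLift (2 * S + 1) U),
        fun U => B.F (configShift (sitePermZd π v) (torusLift (2 * S + 1) U));
        wilsonMeasure (d := 4) (L := 2 * S + 1) r.ρ β] =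
      cov[fun U => (permSpecies π A).F (torusLift (2 * S + 1) U),
        fun U => (permSpecies π B).F (configShift v (torusLift (2 * S + 1) U));
        wilsonMeasure (d := 4) (L := 2 * S + 1) r.ρ β] := by
  have h1 : (fun U : GaugeConfig 4 (2 * S + 1) G => (permSpecies π A).F (torusLift (2 * S + 1) U)) =
      (fun U => A.F (torusLift (2 * S + 1) U)) ∘ configPerm π := by
    funext U
    simp only [permSpecies_F, Function.comp_apply, configPermZd_torusLift]
  have h2 : (fun U : GaugeConfig 4 (2 * S + 1) G =>
        (permSpecies π B).F (configShift v (torusLift (2 * S + 1) U))) =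
      (fun U => B.F (configShift (sitePermZd π v) (torusLift (2 * S + 1) U))) ∘ configPerm π := by
    funext U
    simp only [permSpecies_F, Function.comp_apply, configPermZd_configShift, configPermZd_torusLift]
  rw [h1, h2, ← covariance_map_equiv, wilsonMeasure_map_configPerm r.ρ r.continuous β π]

end AxisIsotropy

/-- **STUB 4 · `stub_axisIsotropy`** of the line `sup-axis-reflection-transfer` of crux
`stmt-QuantumFields-9442` — **axis isotropy of cubic axis moments**: all-pairs cubic axis moments of the
torus Wilson covariances along the Euclidean-time axis `0` give all-pairs cubic axis moments along every
axis `μ`, for every compact `G`, every lattice representation `r` and every `β`. Given `μ, A, B`, apply the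
hypothesis to the permuted pair `(A^π, B^π)`, `π = Equiv.swap 0 μ` (`AxisIsotropy.permSpecies`); every
summand of the conclusion equals the corresponding summand for that pair (`AxisIsotropy.covariance_perm`
with `v = -(n e₀)`, `sitePermZd π (n e₀) = n e_μ`). [folklore] -/
theorem stub_axisIsotropy : ∀ (G : Type) [Group G] [TopologicalSpace G] [IsTopologicalGroup G] [CompactSpace G] [MeasurableSpace G] [BorelSpace G] (r : Literature.MathematicalPhysics.QuantumFieldTheory.LatticeRep G) (β : ℝ), (∀ A B : Literature.MathematicalPhysics.QuantumFieldTheory.YMSpecies G, ∃ M : ℝ, ∀ S : ℕ, ∑ n ∈ Finset.range (S + 1), ((n : ℝ) + 1) ^ 3 * |ProbabilityTheory.covariance (fun U => A.F (Literature.MathematicalPhysics.QuantumLattice.torusLift (2 * S + 1) U)) (fun U => B.F (Literature.MathematicalPhysics.QuantumLattice.configShift (-(Pi.single 0 (n : ℤ))) (Literature.MathematicalPhysics.QuantumLattice.torusLift (2 * S + 1) U))) (Literature.MathematicalPhysics.QuantumFieldTheory.wilsonMeasure (d := 4) (L := 2 * S + 1) r.ρ β)| ≤ M) → ∀ (μ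 : Fin 4) (A B : Literature.MathematicalPhysics.QuantumFieldTheory.YMSpecies G), ∃ M : ℝ, ∀ S : ℕ, ∑ n ∈ Finset.range (S + 1), ((n : ℝ) + 1) ^ 3 * |ProbabilityTheory.covariance (fun U => A.F (Literature.MathematicalPhysics.QuantumLattice.torusLift (2 * S + 1) U)) (fun U => B.F (Literature.MathematicalPhysics.QuantumLattice.configShift (-(Pi.single μ (n : ℤ))) (Literature.MathematicalPhysics.QuantumLattice.torusLift (2 * S + 1) U))) (Literature.MathematicalPhysics.QuantumFieldTheory.wilsonMeasure (d := 4) (L := 2 * S + 1) r.ρ β)| ≤ M := by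
  intro G _ _ _ _ _ _ r β h μ A B
  obtain ⟨M, hM⟩ := h (AxisIsotropy.permSpecies (Equiv.swap 0 μ) A)
    (AxisIsotropy.permSpecies (Equiv.swap 0 μ) B)
  refine ⟨M, fun S => le_of_eq_of_le (Finset.sum_congr rfl fun n _ => ?_) (hM S)⟩
  have key := AxisIsotropy.covariance_perm r β (Equiv.swap 0 μ) A B S (-(Pi.single 0 (n : ℤ)))
  rw [AxisIsotropy.sitePermZd_neg, sitePermZd_single, Equiv.swap_apply_left] at key
  rw [key]

end Summit.QuantumFields.YangMills.Theorems.FiniteSusceptibilityWeakCoupling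

end
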